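import Mathlib
import Summits.ABC.ABC.Theses.IsogenyGlueCongruence
import Literature.NumberTheory.EllipticCurves.BSDSha
import Literature.NumberTheory.EllipticCurves.MordellWeil
import Literature.NumberTheory.EllipticCurves.Isogeny

/-!
# Sketch — crux-ideate stmt-ABC-2157 (TorsionSharingPrimeBound), ideator 2, round 1

First lemmas of the two idea cards `sturm-first-disagreement` and `visible-excess-rank`.
Nothing here is a route item; statements are `Prop`s over existing declarations plus two
elementary shells that are proved.
-/

namespace Summit.ABC.ABC.Cruxes.TorsionSharingPrimeBound.SketchIdeator2

open Literature.NumberTheory.EllipticCurves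
open Literature.NumberTheory.EllipticCurves.ModularForms

/-! ## Card `sturm-first-disagreement` -/

/-- Arithmetic shell of Sturm's "Case B" for a RATIONAL partner: a prime dividing a non-zero
difference of two integers of absolute value `≤ B` is at most `2B`. -/
theorem prime_le_of_dvd_sub {ℓ : ℕ} {a b : ℤ} {B : ℕ} (hℓ : ℓ.Prime) (hab : a ≠ b)
    (hdvd : (ℓ : ℤ) ∣ a - b) (ha : |a| ≤ B) (hb : |b| ≤ B) : ℓ ≤ 2 * B := by
  have hne : a - b ≠ 0 := sub_ne_zero.mpr hab
  have h1 : (ℓ : ℤ) ≤ |a - b| := Int.le_of_dvd (abs_pos.mpr hne) ((dvd_abs _ _).mpr hdvd)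
  have h2 : |a - b| ≤ |a| + |b| := abs_sub a b
  have _ := hℓ.pos
  omega

/-- `SturmPairBound`: the d = 1 ("two rational newforms") case of the crux in the SAME coefficient
form as `TorsionSharingPrimeBound` — two non-isogenous elliptic curves over `ℚ` whose `a_p`
agree modulo a prime `ℓ` for all primes `p ∤ N N' ℓ` have `ℓ ≤ C · (N N')^4`.  Claimed PROVABLE
NOW from Sturm's bound (tree: `ModularCurveSturmWidthProofs`), modularity, Faltings' isogeny
theorem and the Hasse bound (Kraus–Oesterlé 1992 set-up); it implies the route item
`PolyFreyMazurPairs` (stmt-ABC-2047) with κ = 4 once `E[ℓ] ≅ E'[ℓ] ⇒ a_p ≡ a'_p (mod ℓ)` is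
supplied.  The exponent 4 is crude (3/2 + ε is what the argument gives). -/
def SturmPairBound : Prop :=
  ∃ C : ℝ, ∀ (W W' : WeierstrassCurve ℚ) [W.IsElliptic] [W'.IsElliptic]
    [NeZero (W.conductorNorm ℤ)] [NeZero (W'.conductorNorm ℤ)],
    ¬ W.IsIsogenous W' → ∀ ℓ : ℕ, ℓ.Prime →
    (∀ p : ℕ, p.Prime → ¬ (p ∣ W.conductorNorm ℤ * W'.conductorNorm ℤ * ℓ) →
        ((W.LFunction p : ℤ) : ZMod ℓ) = ((W'.LFunction p : ℤ) : ZMod ℓ)) →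
    (ℓ : ℝ) ≤ C * ((W.conductorNorm ℤ : ℝ) * (W'.conductorNorm ℤ : ℝ)) ^ (4 : ℝ)

/-- The crux's hypothesis (congruence of `g` with `f_W` through `φ : R → F`, `char F = ℓ`) packaged
as a predicate, verbatim from the route decl, for re-use below. -/
def CongruentPartner (W : WeierstrassCurve ℚ) (M : ℕ) (g : CuspForm (CongruenceSubgroup.Gamma0 M) 2)
    (ℓ : ℕ) : Prop :=
  ∃ (R : Subring ℂ) (F : Type) (_ : Field F) (_ : CharP F ℓ) (φ : R →+* F)
    (hg : ∀ n : ℕ, cuspCoeff g n ∈ R),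
    ∀ p : ℕ, p.Prime → ¬ (p ∣ M * W.conductorNorm ℤ * ℓ) →
      φ ⟨cuspCoeff g p, hg p⟩ = ((W.LFunction p : ℤ) : F)

/-- Order of vanishing `≥ r` at the centre `s = 1` of the (entire continuation of the) completed
L-function of a weight-2 cusp form of level `M`. -/
def CentralVanishingAtLeast (M : ℕ) (g : CuspForm (CongruenceSubgroup.Gamma0 M) 2) (r : ℕ) : Prop :=
  ∀ Λ ∈ completedCuspFormLContinuations M g, ∀ j : ℕ, j < r → iteratedDeriv j Λ 1 = 0

/-! ## Card `visible-excess-rank` -/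

/-- `ExcessRankVisibleSha` — the card's first real stub (Agashe–Stein visibility, 𝔪-adic form,
plus Gross–Zagier–Kolyvagin–Logachëv for the partner): a SAME-LEVEL congruence partner `g` of the
semistable curve `W` at a prime `ℓ > N + 1` whose central order of vanishing exceeds the
Mordell–Weil rank of `W` by at least `2` forces a non-zero `ℓ`-torsion element of `Ш(W/ℚ)`. -/
def ExcessRankVisibleSha : Prop :=
  ∀ (W : WeierstrassCurve ℚ) [W.IsElliptic] [W.IsGloballyMinimal] [NeZero (W.conductorNorm ℤ)],
    W.IsSemistable ℤ →
    ∀ (g : CuspForm (CongruenceSubgroup.Gamma0 (W.conductorNorm ℤ)) 2),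
    IsNewform0 g → ¬ IsNewformOf W g →
    ∀ ℓ : ℕ, ℓ.Prime → W.conductorNorm ℤ + 1 < ℓ →
    CongruentPartner W (W.conductorNorm ℤ) g ℓ →
    CentralVanishingAtLeast (W.conductorNorm ℤ) g (W.mordellWeilRank + 2) →
    ∃ ξ : W.galH1, ξ ∈ W.sha ∧ ξ ≠ 0 ∧ (ℓ : ℤ) • ξ = 0

/-- Group-theoretic shell of the visibility count (Agashe–Stein 2002, Thm. 3.1, linear-algebra
core): if an `𝔽_ℓ`-vector space `V` (think `B(ℚ)/λB(ℚ)`) maps to `S` (think `Ш(A)[ℓ]`) with kernel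
of dimension at most `r` (think `rank A(ℚ)`), then `dim V ≤ r + dim S`. -/
theorem finrank_le_of_ker_le {F : Type*} [Field F] {V S : Type*} [AddCommGroup V] [Module F V]
    [AddCommGroup S] [Module F S] [FiniteDimensional F V] [FiniteDimensional F S]
    (f : V →ₗ[F] S) (r : ℕ) (hker : Module.finrank F (LinearMap.ker f) ≤ r) :
    Module.finrank F V ≤ r + Module.finrank F S := by
  have h := LinearMap.finrank_range_add_finrank_ker f
  have hr : Module.finrank F (LinearMap.range f) ≤ Module.finrank F S :=
    Submodule.finrank_le _
  omega

/-- How the card would conclude the crux IN ITS REGIME (shape only): the visible-Ш stub plus a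
bound `#Ш(W)[ℓ^∞] ≤ C N^κ` for analytic-rank-0 semistable curves (a Goldfeld–Szpiro-type
statement — this is where the line meets Szpiro again; recorded, not claimed). -/
def ShaPolyBound : Prop :=
  ∃ κ C : ℝ, ∀ (W : WeierstrassCurve ℚ) [W.IsElliptic] [W.IsGloballyMinimal]
    [NeZero (W.conductorNorm ℤ)], W.IsSemistable ℤ →
    ∀ ℓ : ℕ, ℓ.Prime → (∃ ξ : W.galH1, ξ ∈ W.sha ∧ ξ ≠ 0 ∧ (ℓ : ℤ) • ξ = 0) →
      (ℓ : ℝ) ≤ C * (W.conductorNorm ℤ : ℝ) ^ κ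

end Summit.ABC.ABC.Cruxes.TorsionSharingPrimeBound.SketchIdeator2
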